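import Summits.FinalStateConjecture.FinalStateConjecture.Theorems.EIHFluxBalanceInertialRecessionStubRechart3Frames
import Summits.FinalStateConjecture.FinalStateConjecture.Theorems.EIHFluxBalanceInertialRecessionStubRechart3Chain
import Summits.FinalStateConjecture.FinalStateConjecture.Theorems.EIHFluxBalanceInertialRecessionStubRechartLeibniz
import Summits.FinalStateConjecture.FinalStateConjecture.Theorems.EIHFluxBalanceInertialRecessionStubRechartCentre

/-!
# Route EIHFluxBalance — `InertialRecession`, re-charting: kinematic data of a hole chart

Helper file for the crux `stmt-FinalStateConjecture-10166`
(`Summit.FinalStateConjecture.FinalStateConjecture.Theses.EIHFluxBalance.InertialRecession`),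
line `sublinear-is-free-clean-window-charges`, stub `stub_rechart` (the transfer P2), part G1.

From a normalised painted frame `Λ̃(t)` (`…StubRechart3Frames`) the honest hole chart
`ψ(τ, z) = c(T) + M(T) z` uses the one-variable data defined here:
* `frameVel Λ = Λ e₀ = u` (4-velocity), `normVel Λ = u/u⁰` (lab-time normalised velocity),
* `frameTilt Λ : E3 →L ℝ`, `z ↦ (Λ(0,z))⁰` (the tilt of the rest slab in lab time),
* `purgedFrame Λ : E3 →L E4`, `z ↦ Λ(0,z) − (frameTilt Λ z) • normVel Λ` (the rest displacement
  purged of its lab-time component: `(purgedFrame Λ z)⁰ = 0`), which is `Λ w` for the purged vector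
  `w` of `…StubRechartCentre` (`purgedFrame_eq_apply_purge`), so the exact painted-radius identity and
  the own-summand identity of that file apply to `c + purgedFrame Λ z`;
* `inverse frame`: `t ↦ (Λ̃ t)⁻¹` is smooth with the same decay (`contDiff_lorentz_symm`,
  `tendsto_iteratedDeriv_lorentz_symm`), by smoothness of ring inversion on the compact set of
  Lorentz matrices of bounded Lorentz factor.
Bounds (`norm_frameTilt_le`, `norm_normVel_le`, `norm_purgedFrame_le`) and the decay of all
derivatives of orders `1, 2, 3` of `t ↦ frameTilt (Λ̃ t)`, `normVel (Λ̃ t)`, `purgedFrame (Λ̃ t)`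
(`tendsto_iteratedDeriv_frameTilt`, `…_normVel`, `…_purgedFrame`) follow from those of `Λ̃`.
[folklore]
-/

noncomputable section

set_option linter.dupNamespace false

open Set Filter Function Metric Topology
open scoped ContDiff
open Literature.Geometry.Lorentzian

namespace Summit.FinalStateConjecture.FinalStateConjecture.Theorems.SublinearIsFree.Rechart

/-! ### The data -/

/-- The painted 4-velocity `u = Λ e₀`. [folklore] -/
def frameVel (Λ : lorentzGroup) : E4 := (Λ : E4 ≃L[ℝ] E4) (E4.basisVector 0)

/-- The lab-time normalised 4-velocity `u/u⁰ = (1, v)`. [folklore] -/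
def normVel (Λ : lorentzGroup) : E4 := ((frameVel Λ) 0)⁻¹ • frameVel Λ

/-- The tilt covector `z ↦ (Λ(0, z))⁰` of the rest slab. [folklore] -/
def frameTilt (Λ : lorentzGroup) : E3 →L[ℝ] ℝ :=
  (EuclideanSpace.proj (0 : Fin 4) : E4 →L[ℝ] ℝ).comp
    (((Λ : E4 ≃L[ℝ] E4) : E4 →L[ℝ] E4).comp E4.spaceEmbed)

/-- The purged rest placement `z ↦ Λ(0,z) − (Λ(0,z))⁰ • (u/u⁰)` (lab-time component removed). [folklore] -/
def purgedFrame (Λ : lorentzGroup) : E3 →L[ℝ] E4 :=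
  ((Λ : E4 ≃L[ℝ] E4) : E4 →L[ℝ] E4).comp E4.spaceEmbed - (frameTilt Λ).smulRight (normVel Λ)

/-! ### Algebra -/

/-- `|u⁰| ≥ 1`, hence `u⁰ ≠ 0`. [folklore] -/
theorem frameVel_zero_ne_zero (Λ : lorentzGroup) : frameVel Λ 0 ≠ 0 := fun h ↦ by
  have := one_le_abs_lorentz_apply_zero Λ
  rw [frameVel] at h
  rw [h, abs_zero] at this
  exact absurd this (by norm_num)

/-- Unfolding lemma for the tilt. [folklore] -/
theorem frameTilt_apply (Λ : lorentzGroup) (z : E3) :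
    frameTilt Λ z = ((Λ : E4 ≃L[ℝ] E4) (E4.ofTimeSpace 0 z)) 0 := by
  simp [frameTilt, E4.spaceEmbed_apply]

/-- Unfolding lemma for the purged placement. [folklore] -/
theorem purgedFrame_apply (Λ : lorentzGroup) (z : E3) :
    purgedFrame Λ z = (Λ : E4 ≃L[ℝ] E4) (E4.ofTimeSpace 0 z) - (frameTilt Λ z) • normVel Λ := by
  simp [purgedFrame, E4.spaceEmbed_apply]

/-- `(u/u⁰)⁰ = 1`. [folklore] -/
theorem normVel_apply_zero (Λ : lorentzGroup) : normVel Λ 0 = 1 := by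
  rw [normVel, PiLp.smul_apply, smul_eq_mul, inv_mul_cancel₀ (frameVel_zero_ne_zero Λ)]

/-- `u = u⁰ • (u/u⁰)`. [folklore] -/
theorem frameVel_eq_smul_normVel (Λ : lorentzGroup) : frameVel Λ = (frameVel Λ 0) • normVel Λ := by
  rw [normVel, smul_smul, mul_inv_cancel₀ (frameVel_zero_ne_zero Λ), one_smul]

/-- **The purged placement is the frame applied to the purged vector** of `…StubRechartCentre`:
`purgedFrame Λ z̃ = Λ ((0, z̃) − ((Λ(0,z̃))⁰/(Λe₀)⁰) e₀)`. [folklore] -/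
theorem purgedFrame_eq_apply_purge (Λ : lorentzGroup) (z : E4) :
    purgedFrame Λ (E4.spatial z) = (Λ : E4 ≃L[ℝ] E4) (E4.ofTimeSpace 0 (E4.spatial z) -
      ((((Λ : E4 ≃L[ℝ] E4) (E4.ofTimeSpace 0 (E4.spatial z))) 0) /
        (((Λ : E4 ≃L[ℝ] E4) (E4.basisVector 0)) 0)) • E4.basisVector 0) := by
  rw [purgedFrame_apply, map_sub, map_smul, frameTilt_apply, normVel, frameVel, smul_smul,
    div_eq_mul_inv]

/-- **The purged placement is purely spatial**: `(purgedFrame Λ z)⁰ = 0`. [folklore] -/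
theorem purgedFrame_apply_zero (Λ : lorentzGroup) (z : E3) : purgedFrame Λ z 0 = 0 := by
  rw [purgedFrame_apply, PiLp.sub_apply, PiLp.smul_apply, smul_eq_mul, normVel_apply_zero, mul_one,
    frameTilt_apply, sub_self]

/-- `purgedFrame Λ z + (frameTilt Λ z) • (u/u⁰) = Λ (0, z)`. [folklore] -/
theorem purgedFrame_add (Λ : lorentzGroup) (z : E3) :
    purgedFrame Λ z + (frameTilt Λ z) • normVel Λ = (Λ : E4 ≃L[ℝ] E4) (E4.ofTimeSpace 0 z) := by
  rw [purgedFrame_apply, sub_add_cancel]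

/-- **The frozen differential is the frame**: for every `v`,
`v⁰ • u + (frameTilt Λ ṽ) • (u/u⁰) + purgedFrame Λ ṽ = Λ v` — wait, more precisely
`(u⁰ v⁰ + frameTilt Λ ṽ) • (u/u⁰) + purgedFrame Λ ṽ = Λ v`. [folklore] -/
theorem frozen_differential (Λ : lorentzGroup) (v : E4) :
    ((frameVel Λ 0) * v 0 + frameTilt Λ (E4.spatial v)) • normVel Λ + purgedFrame Λ (E4.spatial v) =
      (Λ : E4 ≃L[ℝ] E4) v := by
  have hv : v = (v 0) • E4.basisVector 0 + E4.ofTimeSpace 0 (E4.spatial v) := by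
    have h := E4.ofTimeSpace_time_spatial v
    rw [E4.time_apply] at h
    conv_lhs => rw [← h]
    rw [E4.ofTimeSpace_eq_smul_add', E4.spaceEmbed_apply]
  conv_rhs => rw [hv, map_add, map_smul, show (Λ : E4 ≃L[ℝ] E4) (E4.basisVector 0) = frameVel Λ from rfl,
    frameVel_eq_smul_normVel Λ, ← purgedFrame_add Λ (E4.spatial v)]
  rw [add_smul, smul_smul, mul_comm (v 0)]
  abel

/-! ### Bounds -/

/-- `‖frameTilt Λ‖ ≤ ‖Λ‖`. [folklore] -/
theorem norm_frameTilt_le (Λ : lorentzGroup) :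
    ‖frameTilt Λ‖ ≤ ‖((Λ : E4 ≃L[ℝ] E4) : E4 →L[ℝ] E4)‖ := by
  refine ContinuousLinearMap.opNorm_le_bound _ (norm_nonneg _) fun z ↦ ?_
  rw [frameTilt_apply, Real.norm_eq_abs]
  calc |((Λ : E4 ≃L[ℝ] E4) (E4.ofTimeSpace 0 z)) 0| ≤ ‖(Λ : E4 ≃L[ℝ] E4) (E4.ofTimeSpace 0 z)‖ := by
        simpa using PiLp.norm_apply_le ((Λ : E4 ≃L[ℝ] E4) (E4.ofTimeSpace 0 z)) 0
    _ ≤ ‖((Λ : E4 ≃L[ℝ] E4) : E4 →L[ℝ] E4)‖ * ‖E4.ofTimeSpace 0 z‖ :=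
        ((Λ : E4 ≃L[ℝ] E4) : E4 →L[ℝ] E4).le_opNorm _
    _ = ‖((Λ : E4 ≃L[ℝ] E4) : E4 →L[ℝ] E4)‖ * ‖z‖ := by
        rw [norm_eq_spatialNorm_of_apply_zero_eq_zero (E4.ofTimeSpace_apply_zero 0 z),
          E4.spatialNorm_ofTimeSpace]

/-- `‖u/u⁰‖ ≤ ‖u‖ ≤ ‖Λ‖` (as `|u⁰| ≥ 1`). [folklore] -/
theorem norm_normVel_le (Λ : lorentzGroup) : ‖normVel Λ‖ ≤ ‖((Λ : E4 ≃L[ℝ] E4) : E4 →L[ℝ] E4)‖ := by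
  have h1 := one_le_abs_lorentz_apply_zero Λ
  rw [normVel, norm_smul, norm_inv, Real.norm_eq_abs, frameVel]
  calc |((Λ : E4 ≃L[ℝ] E4) (E4.basisVector 0)) 0|⁻¹ * ‖(Λ : E4 ≃L[ℝ] E4) (E4.basisVector 0)‖
      ≤ 1 * ‖(Λ : E4 ≃L[ℝ] E4) (E4.basisVector 0)‖ :=
        mul_le_mul_of_nonneg_right (inv_le_one_of_one_le₀ h1) (norm_nonneg _)
    _ ≤ ‖((Λ : E4 ≃L[ℝ] E4) : E4 →L[ℝ] E4)‖ * ‖E4.basisVector 0‖ := by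
        rw [one_mul]; exact ((Λ : E4 ≃L[ℝ] E4) : E4 →L[ℝ] E4).le_opNorm _
    _ = ‖((Λ : E4 ≃L[ℝ] E4) : E4 →L[ℝ] E4)‖ := by simp

/-- `‖spaceEmbed‖ ≤ 1`. [folklore] -/
theorem norm_spaceEmbed_le_one : ‖(E4.spaceEmbed : E3 →L[ℝ] E4)‖ ≤ 1 :=
  ContinuousLinearMap.opNorm_le_bound _ zero_le_one fun z ↦ by
    rw [one_mul, E4.spaceEmbed_apply, norm_eq_spatialNorm_of_apply_zero_eq_zero
      (E4.ofTimeSpace_apply_zero 0 z), E4.spatialNorm_ofTimeSpace]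

/-- `‖purgedFrame Λ‖ ≤ ‖Λ‖ + ‖Λ‖²`. [folklore] -/
theorem norm_purgedFrame_le (Λ : lorentzGroup) :
    ‖purgedFrame Λ‖ ≤ ‖((Λ : E4 ≃L[ℝ] E4) : E4 →L[ℝ] E4)‖ + ‖((Λ : E4 ≃L[ℝ] E4) : E4 →L[ℝ] E4)‖ ^ 2 := by
  rw [purgedFrame]
  refine (norm_sub_le _ _).trans (add_le_add ?_ ?_)
  · refine (ContinuousLinearMap.opNorm_comp_le _ _).trans ?_
    calc _ ≤ ‖((Λ : E4 ≃L[ℝ] E4) : E4 →L[ℝ] E4)‖ * 1 :=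
          mul_le_mul_of_nonneg_left norm_spaceEmbed_le_one (norm_nonneg _)
      _ = _ := mul_one _
  · rw [ContinuousLinearMap.norm_smulRight_apply, sq]
    exact mul_le_mul (norm_frameTilt_le Λ) (norm_normVel_le Λ) (norm_nonneg _) (norm_nonneg _)

/-! ### Smoothness and decay along a normalised frame -/

section Path

variable (Λ : ℝ → lorentzGroup)
  (hΛ : ContDiff ℝ ∞ (fun t ↦ ((Λ t : E4 ≃L[ℝ] E4) : E4 →L[ℝ] E4)))
  (hdec : ∀ m, 1 ≤ m → m ≤ 3 → Tendsto (fun t ↦ iteratedDeriv m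
    (fun s ↦ ((Λ s : E4 ≃L[ℝ] E4) : E4 →L[ℝ] E4)) t) atTop (𝓝 0))
  {γ : ℝ} (hγ : ∀ t, |((Λ t : E4 ≃L[ℝ] E4) (E4.basisVector 0)) 0| ≤ γ)
  (hpos : ∀ t, 0 < ((Λ t : E4 ≃L[ℝ] E4) (E4.basisVector 0)) 0)

include hΛ in
/-- The 4-velocity path is smooth. [folklore] -/
theorem contDiff_frameVel : ContDiff ℝ ∞ fun t ↦ frameVel (Λ t) := hΛ.clm_apply contDiff_const

include hΛ in
/-- The tilt path is smooth. [folklore] -/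
theorem contDiff_frameTilt : ContDiff ℝ ∞ fun t ↦ frameTilt (Λ t) :=
  ((contDiff_const (c := (EuclideanSpace.proj (0 : Fin 4) : E4 →L[ℝ] ℝ))).clm_comp
    (hΛ.clm_comp contDiff_const))

include hΛ in
/-- The normalised velocity path is smooth. [folklore] -/
theorem contDiff_normVel : ContDiff ℝ ∞ fun t ↦ normVel (Λ t) :=
  contDiff_iff_contDiffAt.mpr fun t ↦ by
    have h0 : ContDiffAt ℝ ∞ (fun w : E4 ↦ w 0) (frameVel (Λ t)) :=
      (EuclideanSpace.proj (0 : Fin 4) : E4 →L[ℝ] ℝ).contDiff.contDiffAt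
    have hG : ContDiffAt ℝ ∞ (fun w : E4 ↦ (w 0)⁻¹ • w) (frameVel (Λ t)) :=
      (h0.inv (frameVel_zero_ne_zero (Λ t))).smul contDiffAt_id
    have heq : (fun t ↦ normVel (Λ t)) = (fun w : E4 ↦ (w 0)⁻¹ • w) ∘ (fun t ↦ frameVel (Λ t)) := rfl
    rw [heq]
    exact hG.comp t (contDiff_frameVel Λ hΛ).contDiffAt

include hΛ in
/-- The purged placement path is smooth. [folklore] -/
theorem contDiff_purgedFrame : ContDiff ℝ ∞ fun t ↦ purgedFrame (Λ t) :=
  (hΛ.clm_comp contDiff_const).sub ((contDiff_frameTilt Λ hΛ).smulRight (contDiff_normVel Λ hΛ))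

include hΛ hdec in
/-- Decay of the derivatives of the 4-velocity. [folklore] -/
theorem tendsto_iteratedDeriv_frameVel : ∀ m, 1 ≤ m → m ≤ 3 →
    Tendsto (fun t ↦ iteratedDeriv m (fun s ↦ frameVel (Λ s)) t) atTop (𝓝 0) := by
  intro m hm1 hm3
  have h := hdec m hm1 hm3
  have heq : ∀ t, iteratedDeriv m (fun s ↦ frameVel (Λ s)) t =
      iteratedDeriv m (fun s ↦ ((Λ s : E4 ≃L[ℝ] E4) : E4 →L[ℝ] E4)) t (E4.basisVector 0) :=
    fun t ↦ iteratedDeriv_clm_apply_const hΛ _ m t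
  simp_rw [heq]
  have h' := ((ContinuousLinearMap.apply ℝ E4 (E4.basisVector 0)).continuous.tendsto 0).comp h
  rw [map_zero] at h'
  exact h'

include hΛ hdec in
/-- Decay of the derivatives of the tilt. [folklore] -/
theorem tendsto_iteratedDeriv_frameTilt : ∀ m, 1 ≤ m → m ≤ 3 →
    Tendsto (fun t ↦ iteratedDeriv m (fun s ↦ frameTilt (Λ s)) t) atTop (𝓝 0) := by
  intro m hm1 hm3
  -- `frameTilt (Λ s) = L (Λ s)` for the fixed continuous linear map `L X = proj₀ ∘ X ∘ spaceEmbed`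
  set L : (E4 →L[ℝ] E4) →L[ℝ] (E3 →L[ℝ] ℝ) :=
    ((ContinuousLinearMap.compL ℝ E3 E4 ℝ) (EuclideanSpace.proj (0 : Fin 4) : E4 →L[ℝ] ℝ)).comp
      ((ContinuousLinearMap.compL ℝ E3 E4 E4).flip E4.spaceEmbed) with hL
  have hLapp : ∀ s, frameTilt (Λ s) = L ((Λ s : E4 ≃L[ℝ] E4) : E4 →L[ℝ] E4) := fun s ↦ rfl
  simp_rw [hLapp]
  have heq : ∀ t, iteratedDeriv m (fun s ↦ L ((Λ s : E4 ≃L[ℝ] E4) : E4 →L[ℝ] E4)) t =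
      L (iteratedDeriv m (fun s ↦ ((Λ s : E4 ≃L[ℝ] E4) : E4 →L[ℝ] E4)) t) :=
    fun t ↦ iteratedDeriv_clm_comp L hΛ m t
  simp_rw [heq]
  have h' := (L.continuous.tendsto 0).comp (hdec m hm1 hm3)
  rw [map_zero] at h'
  exact h'

include hΛ hdec hγ hpos in
/-- Decay of the derivatives of the normalised velocity (Faà di Bruno through `w ↦ w/w⁰` on the
compact set `{1 ≤ w⁰, ‖w‖ ≤ 2γ}`). [folklore] -/
theorem tendsto_iteratedDeriv_normVel : ∀ m, 1 ≤ m → m ≤ 3 →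
    Tendsto (fun t ↦ iteratedDeriv m (fun s ↦ normVel (Λ s)) t) atTop (𝓝 0) := by
  have hc0 : Continuous fun w : E4 ↦ w 0 := (EuclideanSpace.proj (0 : Fin 4) : E4 →L[ℝ] ℝ).continuous
  set O : Set E4 := {w | 1 / 2 < w 0} with hO
  set K : Set E4 := {w | 1 ≤ w 0} ∩ closedBall 0 (2 * γ) with hK
  have hOo : IsOpen O := isOpen_lt continuous_const hc0
  have hKc : IsCompact K :=
    (isCompact_closedBall (0 : E4) (2 * γ)).inter_left (isClosed_le continuous_const hc0)
  have hKO : K ⊆ O := fun w hw ↦ by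
    have : 1 ≤ w 0 := hw.1
    show 1 / 2 < w 0
    linarith
  have hg : ContDiffOn ℝ ∞ (fun w : E4 ↦ (w 0)⁻¹ • w) O := fun w hw ↦ by
    have hw0 : w 0 ≠ 0 := by have : 1 / 2 < w 0 := hw; positivity
    exact (((EuclideanSpace.proj (0 : Fin 4) : E4 →L[ℝ] ℝ).contDiff.contDiffAt.inv hw0).smul
      contDiffAt_id).contDiffWithinAt
  have h1 : ∀ t, 1 ≤ frameVel (Λ t) 0 := fun t ↦ by
    have := one_le_abs_lorentz_apply_zero (Λ t)
    rwa [abs_of_pos (hpos t)] at this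
  have hnorm : ∀ t, ‖frameVel (Λ t)‖ ≤ 2 * γ := fun t ↦ by
    set u : E4 := frameVel (Λ t) with hu
    have h := norm_sq_eq_sq_add_spatialNorm_sq u
    have hsq : (u 0) ^ 2 = 1 + E4.spatialNorm u ^ 2 := lorentz_apply_zero_sq (Λ t)
    have hu0 : 0 < u 0 := hpos t
    have huγ : u 0 ≤ γ := (le_abs_self _).trans (hγ t)
    have h2 : ‖u‖ ^ 2 ≤ (2 * γ) ^ 2 := by
      rw [h]
      have := pow_le_pow_left₀ hu0.le huγ 2
      nlinarith
    exact le_of_pow_le_pow_left₀ two_ne_zero (by linarith [hu0.le.trans huγ]) h2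
  have hwK : ∀ t, frameVel (Λ t) ∈ K := fun t ↦ ⟨h1 t, by simpa using hnorm t⟩
  exact tendsto_iteratedDeriv_comp_of_isCompact hOo hKc hKO hg
    ((contDiff_frameVel Λ hΛ).of_le (WithTop.coe_le_coe.mpr le_top)) hwK
    (tendsto_iteratedDeriv_frameVel Λ hΛ hdec)

include hΛ hdec hγ hpos in
/-- Decay of the derivatives of the purged placement. [folklore] -/
theorem tendsto_iteratedDeriv_purgedFrame : ∀ m, 1 ≤ m → m ≤ 3 →
    Tendsto (fun t ↦ iteratedDeriv m (fun s ↦ purgedFrame (Λ s)) t) atTop (𝓝 0) := by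
  intro m hm1 hm3
  -- first part: `Λ ∘ spaceEmbed`, a fixed linear image of the frame
  set L : (E4 →L[ℝ] E4) →L[ℝ] (E3 →L[ℝ] E4) := (ContinuousLinearMap.compL ℝ E3 E4 E4).flip E4.spaceEmbed
    with hL
  have hA : Tendsto (fun t ↦ iteratedDeriv m
      (fun s ↦ ((Λ s : E4 ≃L[ℝ] E4) : E4 →L[ℝ] E4).comp E4.spaceEmbed) t) atTop (𝓝 0) := by
    have heq : ∀ t, iteratedDeriv m (fun s ↦ ((Λ s : E4 ≃L[ℝ] E4) : E4 →L[ℝ] E4).comp E4.spaceEmbed) t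
        = L (iteratedDeriv m (fun s ↦ ((Λ s : E4 ≃L[ℝ] E4) : E4 →L[ℝ] E4)) t) :=
      fun t ↦ iteratedDeriv_clm_comp L hΛ m t
    simp_rw [heq]
    have h' := (L.continuous.tendsto 0).comp (hdec m hm1 hm3)
    rw [map_zero] at h'
    exact h'
  -- second part: the bilinear `smulRight` of tilt and normalised velocity
  letI : NormedAddCommGroup (E4 →L[ℝ] (E3 →L[ℝ] E4)) := ContinuousLinearMap.toNormedAddCommGroup
  letI : NormedSpace ℝ (E4 →L[ℝ] (E3 →L[ℝ] E4)) := ContinuousLinearMap.toNormedSpace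
  have hB := tendsto_iteratedDeriv_bilinear_of_one_le (ContinuousLinearMap.smulRightL ℝ E3 E4)
    (contDiff_frameTilt Λ hΛ) (contDiff_normVel Λ hΛ) 3
    ⟨1 + 3 * γ, Eventually.of_forall fun t ↦ (norm_frameTilt_le (Λ t)).trans
      ((norm_lorentz_le (Λ t)).trans (by linarith [hγ t]))⟩
    ⟨1 + 3 * γ, Eventually.of_forall fun t ↦ (norm_normVel_le (Λ t)).trans
      ((norm_lorentz_le (Λ t)).trans (by linarith [hγ t]))⟩
    (tendsto_iteratedDeriv_frameTilt Λ hΛ hdec) (tendsto_iteratedDeriv_normVel Λ hΛ hdec hγ hpos)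
    m hm1 hm3
  -- assemble
  have hsub : ∀ t, iteratedDeriv m (fun s ↦ purgedFrame (Λ s)) t =
      iteratedDeriv m (fun s ↦ ((Λ s : E4 ≃L[ℝ] E4) : E4 →L[ℝ] E4).comp E4.spaceEmbed) t -
        iteratedDeriv m (fun s ↦ ContinuousLinearMap.smulRightL ℝ E3 E4 (frameTilt (Λ s))
          (normVel (Λ s))) t := by
    intro t
    have h1 : ContDiffAt ℝ m (fun s ↦ ((Λ s : E4 ≃L[ℝ] E4) : E4 →L[ℝ] E4).comp E4.spaceEmbed) t :=
      ((hΛ.clm_comp contDiff_const).of_le (by exact_mod_cast le_top)).contDiffAt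
    have h2 : ContDiffAt ℝ m (fun s ↦ ContinuousLinearMap.smulRightL ℝ E3 E4 (frameTilt (Λ s))
        (normVel (Λ s))) t :=
      (((contDiff_frameTilt Λ hΛ).smulRight (contDiff_normVel Λ hΛ)).of_le
        (by exact_mod_cast le_top)).contDiffAt
    rw [← iteratedDeriv_sub h1 h2]
    rfl
  simp_rw [hsub]
  simpa using hA.sub hB

end Path

/-- Registered one-line form (worker carrier `rechart_purgedFrame_apply_zero`) of
`purgedFrame_apply_zero`, unfolded. [folklore] -/
theorem rechart_purgedFrame_apply_zero : open Literature.Geometry.Lorentzian in ∀ (Λ : lorentzGroup) (z : E3), ((Λ : E4 ≃L[ℝ] E4) (E4.ofTimeSpace 0 z) - (((Λ : E4 ≃L[ℝ] E4) (E4.ofTimeSpace 0 z)) 0) • ((((Λ : E4 ≃L[ℝ] E4) (E4.basisVector 0)) 0)⁻¹ • (Λ : E4 ≃L[ℝ] E4) (E4.basisVector 0))) 0 = 0 := fun Λ z ↦ by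
  have h := purgedFrame_apply_zero Λ z
  rwa [purgedFrame_apply, frameTilt_apply, normVel, frameVel] at h

end Summit.FinalStateConjecture.FinalStateConjecture.Theorems.SublinearIsFree.Rechart

end
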